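import Mathlib
import HarnessLib
import Summits.HubbardSuperconductivity.Statement
import Summits.HubbardSuperconductivity.HubbardSuperconductivity.Theses.WeakCouplingBCS
import Literature.StrongHypotheses.HubbardSuperconductivity
import Literature.Barriers.HubbardSuperconductivity.PureModelStripeCompetition
import Literature.Barriers.HubbardSuperconductivity.HohenbergMerminWagnerPairing
import Literature.Barriers.HubbardSuperconductivity.HohenbergMerminWagnerPairingQuasiAverage
import Literature.MathematicalPhysics.QuantumLattice.DWaveSource
import Literature.MathematicalPhysics.QuantumLattice.HubbardFreePropagatorLimit
import Summits.HubbardSuperconductivity.HubbardSuperconductivity.Theorems.CwThesis.Negative.FreeEndpointCorollaries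

/-!
# Route `WeakCouplingBCS`: BRIDGE AUDIT between the Kohn–Luttinger pair (rung R2d ∧ leaf R2dH1, `T > 0`) and the
summit `HubbardSuperconductivity` (`T = 0`, every-ground-state `d_{x²-y²}` pair-field LRO)

Support file (`--supports stmt-HubbardSuperconductivity-2007`, the route target `WcbcsThesis`) for LADDER-Hubbard
v1.17 WORDING OF RECORD (ii), «GAP OF RECORD»: the KL theorem line concludes a positive-temperature normal-phase
statement (leaf of record `…Theses.WeakCouplingBCS.H1TwoPointLimitKLScaleD`: thermodynamic limit of the thermal
two-point function for `0 < β ≤ e^{c/U²}`, `δ ∈ [0.10, 0.35]`; certificate half `WcbcsKohnLuttingerB1g`), whereas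
the summit quantifies over EVERY sector ground state of the source-free canonical model on even tori and asserts
pair-field long-range order. This file records, sorry-free and BY NAME (so that restatements of the route items
cannot make it stale), the logical map between the registered statements:

§1 The lattice of summit-strength statements (pure logic over `HasDWavePairFieldLROAt U δ`):
* `hubbardSuperconductivity_of_wcbcsThesis` — the route target (rev 2, `δ ∈ (0,1/2)`) implies the summit outright;
* `weakCouplingDWaveWindow_imp_wcbcsThesis` — the registered strong hypothesis `WeakCouplingDWaveWindow`
  (Raghu–Kivelson–Scalapino: `∀ δ ∈ (0, 2/5) ∃ U₀(δ) ∀ U ∈ (0, U₀)`) implies the route target (`δ := 1/5`), hence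
  `WeakCouplingDWaveWindow → WcbcsThesis → HubbardSuperconductivity` factors the landed bridge;
* `dopingWindow_of_weakCouplingDWaveWindow`, `wcbcsThesis_of_dopingWindow`, `hubbardSuperconductivity_of_dopingWindow`
  — the POINTWISE WINDOW form `∀ δ ∈ [a, b] ∃ U₀(δ) ∀ U ∈ (0, U₀), HasDWavePairFieldLROAt U δ` for any
  `0 < a ≤ b < 1/2`: implied by `WeakCouplingDWaveWindow` when `b < 2/5`, implies `WcbcsThesis` and the summit;
  `hubbardSuperconductivity_of_klWindowDWave` is the instance on the KL theorem window `[0.10, 0.35]` of R2dH1, and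
  `dopingWindow_of_uniformWindow` records that the KL-uniform shape `∃ U₀ ∀ δ ∈ [a,b]` (the quantifier order of
  `H1TwoPointLimitKLScaleD`) is the stronger one.

§2 The positive-temperature passage is CLOSED BY A THEOREM (Koma–Tasaki 1992 / tree barrier
`HohenbergMerminWagnerPairing`): `klRegime_not_thermal_dWavePairFieldLRO` — with the quantifier prefix of
`H1TwoPointLimitKLScaleD` verbatim (`δ ∈ [0.10, 0.35]`, `0 < U ≤ U₀`, `0 < β ≤ e^{c/U²}`, ANY `U₀, c`) and at every
chemical potential `μ`, the Gibbs state of `hubbardTorusWith 2 L 1 U μ` has NO `d_{x²-y²}` pair-field long-range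
order along the even tori. So no hypothesis of the form «KL-regime thermal statement ⇒ thermal pair LRO ⇒ …» can be a
bridge: the KL pair's whole `(δ, U, β)`-box lies inside the Hohenberg–Mermin–Wagner dead zone, and the bridge to the
summit must pass to `T = 0` objects (or to `β = β_L → ∞` with the volume, see the module docstring's table).

§3 What the bridge IS, by name: the route's deciding theorem `closes : WcbcsSsbToTorusLRO → WcbcsBcsConstruction →
HubbardSuperconductivity` uses exactly two `T = 0` hypotheses — (B-constr) a sourced `d`-wave order parameter
`m(U, μ) ≥ e^{-C/U²}` at a density-matched `μ`, all small `U`, ONE `δ` (crux 4), and (B-transfer) sourced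
grand-canonical order ⇒ LRO of EVERY canonical even-torus sector ground state (crux 2) — and does NOT use the KL
pair (`H1TwoPointLimitKLScaleD`, `WcbcsKohnLuttingerB1g` are inputs of the METHOD proposed for crux 4, not premises
of any typed implication into the summit). `weakCouplingDWaveWindow_of_transfer_of_windowConstruction` and
`uniformWindow_of_transfer_of_uniformConstruction` show what the STRONG hypothesis / the KL-window version cost on
top of the summit: the same transfer crux plus a PER-DOPING (resp. doping-uniform) construction — nothing else.

Deliberately NOT here: no new definition, no restatement of any item body (all statements are by name or over the
barrier catalogue's `HasDWavePairFieldLROAt`), nothing about the KLProgramme children. The prose audit with the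
status table (proved / theorem-false / open, per bridge hypothesis) is HOME/hubbard-kl-h1-p2/BRIDGE-AUDIT.md of cell
gate-hubbard-kl. Sources: Koma–Tasaki, PRL 68 (1992) 3248 (Theorem (2), footnote [10]); Koma–Tasaki, J. Stat.
Phys. 76 (1994) 745 §2.5; Raghu–Kivelson–Scalapino, PRB 81 (2010) 224505 §III.B; Arovas–Berg–Kivelson–Raghu,
Annu. Rev. CMP 13 (2022) §1, §5.1; Goto–Koma–Yoshida, Phys. Scr. 101 (2026) 325218 = arXiv:2509.19780 §1 (the
nearest rigorous SC-LRO theorem — attractive `U`, Lieb lattice, half filling, reflection positivity — delivers LRO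
of the zero-temperature LIMIT state and «we may choose a ground state that exhibits the long-range order», p. 45:
SOME ground state, not every).
-/

noncomputable section

namespace Summit.HubbardSuperconductivity.WeakCouplingBCS.KLBridgeAudit

open Filter Set
open Literature.Barriers.HubbardSuperconductivity (HasDWavePairFieldLROAt thermalPairFieldCorr
  not_hasLongRangeOrder_thermalPairFieldCorr_subseq)
open Literature.StrongHypotheses.HubbardSuperconductivity (WeakCouplingDWaveWindow)
open Literature.MathematicalPhysics.QuantumLattice
open Literature.Probability.LatticeModels
open Summit.HubbardSuperconductivity.HubbardSuperconductivity.Theses.WeakCouplingBCS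
  (WcbcsThesis WcbcsSsbToTorusLRO WcbcsBcsConstruction)

/-! ### §1 The lattice of summit-strength statements -/

/-- **Route target ⇒ summit, by name.** `WcbcsThesis` (rev 2: `∃ U₀ > 0, ∃ δ ∈ (0,1/2), ∀ U ∈ (0,U₀),
HasDWavePairFieldLROAt U δ`) implies `HubbardSuperconductivity` (`∃ U > 0, ∃ δ ∈ (0,1/2), HasDWavePairFieldLROAt U δ`
definitionally): instantiate `U := U₀/2`. (The tree's `wcbcsThesis_imp_summitShape_Ioo_one` concludes the weaker
`δ ∈ (0,1)` shape inherited from rev 1; since rev 2 the target carries `δ < 1/2` and the implication is outright.)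
[folklore] -/
theorem hubbardSuperconductivity_of_wcbcsThesis (hX : WcbcsThesis) : _root_.HubbardSuperconductivity := by
  obtain ⟨U₀, hU₀, δ, hδ, h⟩ := hX
  exact ⟨U₀ / 2, half_pos hU₀, δ, hδ, h (U₀ / 2) ⟨half_pos hU₀, half_lt_self hU₀⟩⟩

/-- **Strong hypothesis ⇒ route target.** Raghu–Kivelson–Scalapino's weak-coupling window (`∀ δ ∈ (0, 2/5)`,
`∃ U₀(δ) > 0`, `∀ U ∈ (0, U₀)`, `HasDWavePairFieldLROAt U δ`) implies `WcbcsThesis` (`∃ U₀, ∃ δ ∈ (0,1/2), ∀ U`):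
take `δ := 1/5`. Hence the landed bridge `weakCouplingDWaveWindow_implies_hubbardSuperconductivity` factors through
the route target: RKS's conjecture is STRICTLY ABOVE the route's thesis (it fixes the whole doping interval, the
thesis one doping). [cite: RaghuKivelsonScalapino2010, §III.B p. 6] -/
theorem weakCouplingDWaveWindow_imp_wcbcsThesis (h : WeakCouplingDWaveWindow) : WcbcsThesis := by
  obtain ⟨U₀, hU₀, hU⟩ := h (1 / 5) ⟨by norm_num, by norm_num⟩
  exact ⟨U₀, hU₀, 1 / 5, ⟨by norm_num, by norm_num⟩, hU⟩

/-- **Restriction of the strong hypothesis to a closed doping window** `[a, b] ⊂ (0, 2/5)`: the pointwise window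
form `∀ δ ∈ [a, b], ∃ U₀ > 0, ∀ U ∈ (0, U₀), HasDWavePairFieldLROAt U δ`.
[cite: RaghuKivelsonScalapino2010, §III.B p. 6] -/
theorem dopingWindow_of_weakCouplingDWaveWindow {a b : ℝ} (ha : 0 < a) (hb : b < 2 / 5)
    (h : WeakCouplingDWaveWindow) :
    ∀ δ ∈ Set.Icc a b, ∃ U₀ : ℝ, 0 < U₀ ∧ ∀ U ∈ Set.Ioo (0 : ℝ) U₀, HasDWavePairFieldLROAt U δ :=
  fun δ hδ => h δ ⟨lt_of_lt_of_le ha hδ.1, lt_of_le_of_lt hδ.2 hb⟩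

/-- **Pointwise window ⇒ route target**: for `0 < a ≤ b < 1/2`, the pointwise window form on `[a, b]` implies
`WcbcsThesis` (take `δ := a`). [folklore] -/
theorem wcbcsThesis_of_dopingWindow {a b : ℝ} (ha : 0 < a) (hab : a ≤ b) (hb : b < 1 / 2)
    (h : ∀ δ ∈ Set.Icc a b, ∃ U₀ : ℝ, 0 < U₀ ∧ ∀ U ∈ Set.Ioo (0 : ℝ) U₀, HasDWavePairFieldLROAt U δ) :
    WcbcsThesis := by
  obtain ⟨U₀, hU₀, hU⟩ := h a ⟨le_rfl, hab⟩
  exact ⟨U₀, hU₀, a, ⟨ha, lt_of_le_of_lt hab hb⟩, hU⟩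

/-- **Pointwise window ⇒ summit**: for `0 < a ≤ b < 1/2`, the pointwise window form on `[a, b]` implies
`HubbardSuperconductivity`. [folklore] -/
theorem hubbardSuperconductivity_of_dopingWindow {a b : ℝ} (ha : 0 < a) (hab : a ≤ b) (hb : b < 1 / 2)
    (h : ∀ δ ∈ Set.Icc a b, ∃ U₀ : ℝ, 0 < U₀ ∧ ∀ U ∈ Set.Ioo (0 : ℝ) U₀, HasDWavePairFieldLROAt U δ) :
    _root_.HubbardSuperconductivity :=
  hubbardSuperconductivity_of_wcbcsThesis (wcbcsThesis_of_dopingWindow ha hab hb h)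

/-- **The KL-window instance.** `d_{x²-y²}` pair-field LRO of every sector ground state at every small repulsion,
pointwise on the KL theorem window `δ ∈ [0.10, 0.35]` of the leaf `H1TwoPointLimitKLScaleD`, implies the summit.
This is the weakest «KL-backed» strengthening of the summit that the ladder may cite next to the KL pair; it is
implied by `WeakCouplingDWaveWindow` (`dopingWindow_of_weakCouplingDWaveWindow`, `0.35 < 2/5`) and is NOT implied by
the KL pair (§2, §3). [folklore] -/
theorem hubbardSuperconductivity_of_klWindowDWave
    (h : ∀ δ ∈ Set.Icc (0.10 : ℝ) 0.35, ∃ U₀ : ℝ, 0 < U₀ ∧ ∀ U ∈ Set.Ioo (0 : ℝ) U₀,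
      HasDWavePairFieldLROAt U δ) :
    _root_.HubbardSuperconductivity :=
  hubbardSuperconductivity_of_dopingWindow (a := 0.10) (b := 0.35) (by norm_num) (by norm_num) (by norm_num) h

/-- **Uniform window ⇒ pointwise window.** The KL-uniform quantifier order (`∃ U₀ > 0, ∀ δ ∈ [a, b], ∀ U ∈ (0,U₀)`,
the shape of `H1TwoPointLimitKLScaleD`, whose constants are uniform on the doping window) implies the pointwise
form (`∀ δ, ∃ U₀(δ)`); the converse fails in general (`U₀(δ) → 0` at an endpoint is allowed pointwise — e.g. RKS's
`U₀(δ) → 0` as `δ → 0⁺` at `t' = 0`). [folklore] -/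
theorem dopingWindow_of_uniformWindow {W : Set ℝ}
    (h : ∃ U₀ : ℝ, 0 < U₀ ∧ ∀ δ ∈ W, ∀ U ∈ Set.Ioo (0 : ℝ) U₀, HasDWavePairFieldLROAt U δ) :
    ∀ δ ∈ W, ∃ U₀ : ℝ, 0 < U₀ ∧ ∀ U ∈ Set.Ioo (0 : ℝ) U₀, HasDWavePairFieldLROAt U δ := by
  obtain ⟨U₀, hU₀, hW⟩ := h
  exact fun δ hδ => ⟨U₀, hU₀, hW δ hδ⟩

/-! ### §2 The positive-temperature passage is closed by a theorem -/

/-- **The KL regime lies inside the Hohenberg–Mermin–Wagner dead zone.** With the quantifier prefix of the leaf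
`H1TwoPointLimitKLScaleD` verbatim — ANY `U₀, c`, every `δ ∈ [0.10, 0.35]`, `0 < U ≤ U₀`, `0 < β ≤ e^{c/U²}` — and at
EVERY chemical potential `μ` (in particular at `μ(δ)`): the Gibbs state of the pure repulsive Hubbard torus
`hubbardTorusWith 2 L 1 U μ` has no `d_{x²-y²}` pair-field long-range order along the even tori, i.e.
`¬ HasLongRangeOrder (halfOpenBox 2 (2k)) (torusPullback (thermalPairFieldCorr dWaveFormFactor β 1 U μ) (2k))` — the
summit's conclusion with the ground-state expectation replaced by the thermal one is FALSE throughout the KL box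
(indeed at every `0 ≤ β < ∞`: `not_hasLongRangeOrder_thermalPairFieldCorr_subseq`, Koma–Tasaki 1992 via
McBryan–Spencer). Consequently no bridge «KL-regime statement ⇒ thermal pair LRO ⇒ summit» exists; the bridge must
change the OBJECT (to `T = 0` sector ground states, or to volume-dependent `β_L → ∞`).
[cite: KomaTasakiPRL1992, Theorem eq. (2) and footnote [10]] -/
theorem klRegime_not_thermal_dWavePairFieldLRO (U₀ c : ℝ) :
    ∀ δ ∈ Set.Icc (0.10 : ℝ) 0.35, ∀ U β : ℝ, 0 < U → U ≤ U₀ → 0 < β → β ≤ Real.exp (c / U ^ 2) →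
      ∀ μ : ℝ, ¬ HasLongRangeOrder (fun k => halfOpenBox 2 (2 * k))
        (fun k => torusPullback (thermalPairFieldCorr dWaveFormFactor β 1 U μ) (2 * k)) :=
  fun _δ _hδ U _β _hU _hUle hβ _hβle μ =>
    not_hasLongRangeOrder_thermalPairFieldCorr_subseq dWaveFormFactor 1 U μ hβ.le
      (tendsto_id.const_mul_atTop' two_pos)

/-! ### §3 What the bridge is, by name -/

/-- **The summit from the two `T = 0` bridge hypotheses, by name** — the route's deciding theorem `closes`
re-exported next to the audit: (B-transfer) `WcbcsSsbToTorusLRO` and (B-constr) `WcbcsBcsConstruction` give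
`HubbardSuperconductivity`. The KL pair does not occur. [folklore] -/
theorem hubbardSuperconductivity_of_transfer_of_construction (hT : WcbcsSsbToTorusLRO)
    (hC : WcbcsBcsConstruction) : _root_.HubbardSuperconductivity :=
  Summit.HubbardSuperconductivity.HubbardSuperconductivity.Theses.WeakCouplingBCS.closes hT hC

/-- **What the STRONG hypothesis costs on top of the summit.** The transfer crux `WcbcsSsbToTorusLRO` (by name;
it already quantifies over every `δ ∈ (0,1/2)` and every `μ` at all `U` below its own `U₀`) together with a
PER-DOPING constructive hypothesis on `(0, 2/5)` — for every `δ ∈ (0, 2/5)` there are `U₀(δ), C(δ) > 0` such that for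
all `U ∈ (0, U₀)` some density-matched `μ` carries a sourced `d`-wave order parameter
`dWaveOrderParameter U μ ≥ e^{-C/U²}` (the body of `WcbcsBcsConstruction` with `∃ δ` replaced by `∀ δ ∈ (0,2/5)`) —
imply `WeakCouplingDWaveWindow`. So RKS's conjecture = (per-doping BCS construction) + (the same transfer); the KL
pair enters neither conjunct as a premise. [cite: RaghuKivelsonScalapino2010, §III.B p. 6] -/
theorem weakCouplingDWaveWindow_of_transfer_of_windowConstruction (hT : WcbcsSsbToTorusLRO)
    (hC : ∀ δ ∈ Set.Ioo (0 : ℝ) (2 / 5), ∃ U₀ : ℝ, 0 < U₀ ∧ ∃ C : ℝ, 0 < C ∧ ∀ U ∈ Set.Ioo (0 : ℝ) U₀,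
      ∃ μ : ℝ, Filter.Tendsto (fun L : ℕ =>
          ((hubbardTorusWith 2 (L + 1) 1 U μ).groundStateFunctional totalNumber).re / ((L + 1 : ℕ) : ℝ) ^ 2)
        Filter.atTop (nhds (1 - δ)) ∧ Real.exp (-C / U ^ 2) ≤ dWaveOrderParameter U μ) :
    WeakCouplingDWaveWindow := by
  obtain ⟨U₁, hU₁, hT⟩ := hT
  intro δ hδ
  obtain ⟨U₀, hU₀, C, _hC, hC⟩ := hC δ hδ
  refine ⟨min U₀ U₁, lt_min hU₀ hU₁, fun U hU => ?_⟩
  obtain ⟨μ, hdens, hm⟩ := hC U ⟨hU.1, lt_of_lt_of_le hU.2 (min_le_left _ _)⟩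
  have hδ' : δ ∈ Set.Ioo (0 : ℝ) (1 / 2) := ⟨hδ.1, lt_trans hδ.2 (by norm_num)⟩
  exact hT U ⟨hU.1, lt_of_lt_of_le hU.2 (min_le_right _ _)⟩ δ hδ' μ hdens
    ((hasDWaveOrder_iff _ _).2 (lt_of_lt_of_le (Real.exp_pos _) hm))

/-- **What the KL-UNIFORM window version costs.** The transfer crux plus a DOPING-UNIFORM construction on a
window `W ⊆ (0, 1/2)` (`∃ U₀ C > 0, ∀ δ ∈ W, ∀ U ∈ (0,U₀), ∃ μ` density-matched with
`dWaveOrderParameter U μ ≥ e^{-C/U²}` — the quantifier order of the KL leaf) give the uniform window form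
`∃ U₀ > 0, ∀ δ ∈ W, ∀ U ∈ (0, U₀), HasDWavePairFieldLROAt U δ`. [folklore] -/
theorem uniformWindow_of_transfer_of_uniformConstruction {W : Set ℝ} (hW : W ⊆ Set.Ioo (0 : ℝ) (1 / 2))
    (hT : WcbcsSsbToTorusLRO)
    (hC : ∃ U₀ : ℝ, 0 < U₀ ∧ ∃ C : ℝ, 0 < C ∧ ∀ δ ∈ W, ∀ U ∈ Set.Ioo (0 : ℝ) U₀,
      ∃ μ : ℝ, Filter.Tendsto (fun L : ℕ =>
          ((hubbardTorusWith 2 (L + 1) 1 U μ).groundStateFunctional totalNumber).re / ((L + 1 : ℕ) : ℝ) ^ 2)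
        Filter.atTop (nhds (1 - δ)) ∧ Real.exp (-C / U ^ 2) ≤ dWaveOrderParameter U μ) :
    ∃ U₀ : ℝ, 0 < U₀ ∧ ∀ δ ∈ W, ∀ U ∈ Set.Ioo (0 : ℝ) U₀, HasDWavePairFieldLROAt U δ := by
  obtain ⟨U₁, hU₁, hT⟩ := hT
  obtain ⟨U₀, hU₀, C, _hC, hC⟩ := hC
  refine ⟨min U₀ U₁, lt_min hU₀ hU₁, fun δ hδ U hU => ?_⟩
  obtain ⟨μ, hdens, hm⟩ := hC δ hδ U ⟨hU.1, lt_of_lt_of_le hU.2 (min_le_left _ _)⟩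
  exact hT U ⟨hU.1, lt_of_lt_of_le hU.2 (min_le_right _ _)⟩ δ (hW hδ) μ hdens
    ((hasDWaveOrder_iff _ _).2 (lt_of_lt_of_le (Real.exp_pos _) hm))

/-! ### §4 Independence witness: the leaf's conclusion SHAPE is pairing-blind (appended 2026-08-26)

The KL leaf `H1TwoPointLimitKLScaleD` concludes, on its `(δ, U, β)`-box, the EXISTENCE OF THE THERMODYNAMIC LIMIT of the
thermal two-point function `⟨c†_{xσ} c_{yσ'}⟩_{β,L}` (all sites, spins). That conclusion shape is a THEOREM of the tree at
the free point `U = 0` for every `β, μ` (`tendsto_hubbardThermalTwoPoint_zero_interaction`, BGM 2006 eq. (2.4) as Riemann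
sums), and at the same point the summit matrix FAILS at every `δ ≥ 0` (`CwThesis.Negative.not_hasDWavePairFieldLROAt_zero`:
the free Fermi gas has no `d`-wave pair-field LRO in any sector ground state). So the implication «two-point limit exists on a
box ⇒ `HasDWavePairFieldLROAt`» is not valid by virtue of the conclusion's shape: whatever the KL pair contributes toward the
summit lives in its METHOD (the convergent sign-resolved expansion is the normal-phase half of crux 4's programme), not in
its STATEMENT — consistent with the tree's `hubbardSuperconductivity_of_wcbcsSsbToTorusLRO_of_windowFloor`
(`…WcbcsBcsConstructionThinSufficiency`), which reaches the summit from crux 2 and a `d`-wave order floor WITHOUT the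
Kohn–Luttinger input as a logical hypothesis. -/

/-- **Independence witness at the free point.** (i) For every `β, μ`, all sites `x, y` and spins `σ, σ'`, the free
(`U = 0`) thermal two-point function of the square-lattice Hubbard torus has a thermodynamic limit — the conclusion shape
of the KL leaf `H1TwoPointLimitKLScaleD`, here at `U = 0` and at EVERY `β > 0` or not; and (ii) at `U = 0` the summit
matrix `HasDWavePairFieldLROAt 0 δ` is false for every `δ ≥ 0`. Hence «existence of the two-point thermodynamic limit»
carries no pairing information by itself. [cite: BenfattoGiulianiMastropietro2006, eq. (2.4)] -/
theorem twoPointLimitShape_and_not_matrix_at_zero :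
    (∀ (β μ : ℝ) (x y : Site 2) (σ σ' : Fin 2), ∃ S : ℂ,
        Filter.Tendsto (fun L : ℕ => hubbardThermalTwoPoint β 0 μ L x y σ σ') Filter.atTop (nhds S)) ∧
      ∀ δ : ℝ, 0 ≤ δ → ¬ HasDWavePairFieldLROAt 0 δ :=
  ⟨fun β μ x y σ σ' => ⟨_, tendsto_hubbardThermalTwoPoint_zero_interaction β μ x y σ σ'⟩,
    fun _δ hδ => Summit.HubbardSuperconductivity.CwThesis.Negative.not_hasDWavePairFieldLROAt_zero hδ⟩

/-- **Corollary: the uniform-window hypothesis is FALSE if the coupling window is closed at `U = 0`.** For any doping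
set `W` meeting `[0, ∞)` the variant `∀ δ ∈ W, ∀ U ∈ [0, U₀), HasDWavePairFieldLROAt U δ` (half-open at `0`) fails —
the strict inequality `0 < U` in `WeakCouplingDWaveWindow`, `WcbcsThesis` and the window forms of §1 is load-bearing,
and no bridge may be continuous «down to and including `U = 0`». [folklore] -/
theorem not_window_closed_at_zero {W : Set ℝ} {δ₀ : ℝ} (hδ₀ : δ₀ ∈ W) (hδ₀' : 0 ≤ δ₀) {U₀ : ℝ} (hU₀ : 0 < U₀) :
    ¬ ∀ δ ∈ W, ∀ U ∈ Set.Ico (0 : ℝ) U₀, HasDWavePairFieldLROAt U δ :=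
  fun h => twoPointLimitShape_and_not_matrix_at_zero.2 δ₀ hδ₀' (h δ₀ hδ₀ 0 ⟨le_rfl, hU₀⟩)

/-! ### §5 Quantifier slack in the transfer crux (appended 2026-08-26)

The typed transfer `WcbcsSsbToTorusLRO` is `∃ U₀ ∀ U ∈ (0,U₀) ∀ δ ∈ (0,1/2) ∀ μ` (window uniform in the doping, order
hypothesis = bare positivity `HasDWaveOrder U μ`). The deciding theorem `closes` destructures crux 4 FIRST (obtaining
`δ`, `C` and the density-matched `μ` with the quantitative floor `e^{-C/U²} ≤ m(U,μ)`), so two strictly weaker transfer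
shapes close the route with crux 4 UNCHANGED: the δ-FIRST («swapped») form `∀ δ ∃ U₀(δ) ∀ U ∀ μ` (route-review
recommendation R1 on item 2007, 2026-08-16; the standing disprover's `CruxSwapped`, `Cruxes/WcbcsSsbToTorusLRO/Disproof.lean`
§4, which also explains what it sheds: every phase boundary `δ*(U)` that MOVES as `U → 0⁺` is avoided at fixed `δ`), and
the AT-SCALE form `∀ δ ∀ C > 0 ∃ U₀(δ, C) ∀ U ∀ μ` whose order hypothesis is crux 4's floor `e^{-C/U²} ≤ m(U,μ)` instead
of bare positivity (`CruxAtScale` there). Recorded here in the Theorems tree, by name for crux 4 and the summit, with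
the monotonicity typed ⇒ swapped ⇒ at-scale; and the strong hypothesis needs only the swapped transfer on `(0, 2/5)`. -/

/-- **Typed transfer ⇒ δ-first transfer.** [folklore] -/
theorem swappedTransfer_of_wcbcsSsbToTorusLRO (hT : WcbcsSsbToTorusLRO) :
    ∀ δ ∈ Set.Ioo (0 : ℝ) (1 / 2), ∃ U₀ : ℝ, 0 < U₀ ∧ ∀ U ∈ Set.Ioo (0 : ℝ) U₀, ∀ μ : ℝ,
      Filter.Tendsto (fun L : ℕ =>
          ((hubbardTorusWith 2 (L + 1) 1 U μ).groundStateFunctional totalNumber).re / ((L + 1 : ℕ) : ℝ) ^ 2)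
        Filter.atTop (nhds (1 - δ)) → HasDWaveOrder U μ → HasDWavePairFieldLROAt U δ := by
  obtain ⟨U₀, hU₀, h⟩ := hT
  exact fun δ hδ => ⟨U₀, hU₀, fun U hU μ => h U hU δ hδ μ⟩

/-- **δ-first transfer ⇒ at-scale transfer** (bare positivity is weaker than the floor `e^{-C/U²} ≤ m`, so assuming
the floor asks less of the transfer). [folklore] -/
theorem scaleTransfer_of_swappedTransfer
    (hT : ∀ δ ∈ Set.Ioo (0 : ℝ) (1 / 2), ∃ U₀ : ℝ, 0 < U₀ ∧ ∀ U ∈ Set.Ioo (0 : ℝ) U₀, ∀ μ : ℝ,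
      Filter.Tendsto (fun L : ℕ =>
          ((hubbardTorusWith 2 (L + 1) 1 U μ).groundStateFunctional totalNumber).re / ((L + 1 : ℕ) : ℝ) ^ 2)
        Filter.atTop (nhds (1 - δ)) → HasDWaveOrder U μ → HasDWavePairFieldLROAt U δ) :
    ∀ δ ∈ Set.Ioo (0 : ℝ) (1 / 2), ∀ C : ℝ, 0 < C → ∃ U₀ : ℝ, 0 < U₀ ∧ ∀ U ∈ Set.Ioo (0 : ℝ) U₀, ∀ μ : ℝ,
      Filter.Tendsto (fun L : ℕ =>
          ((hubbardTorusWith 2 (L + 1) 1 U μ).groundStateFunctional totalNumber).re / ((L + 1 : ℕ) : ℝ) ^ 2)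
        Filter.atTop (nhds (1 - δ)) → Real.exp (-C / U ^ 2) ≤ dWaveOrderParameter U μ →
          HasDWavePairFieldLROAt U δ := by
  intro δ hδ C _hC
  obtain ⟨U₀, hU₀, h⟩ := hT δ hδ
  exact ⟨U₀, hU₀, fun U hU μ hdens hm =>
    h U hU μ hdens ((hasDWaveOrder_iff _ _).2 (lt_of_lt_of_le (Real.exp_pos _) hm))⟩

/-- **The weakest transfer of the menu still closes the route with crux 4 unchanged**: the AT-SCALE transfer
(`∀ δ ∈ (0,1/2) ∀ C > 0 ∃ U₀(δ,C) ∀ U ∈ (0,U₀) ∀ μ`, density matching ∧ `e^{-C/U²} ≤ dWaveOrderParameter U μ` ⇒ matrix)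
and `WcbcsBcsConstruction` (by name) give `HubbardSuperconductivity`. Proof = `closes` with the destructuring order
made explicit. [folklore] -/
theorem hubbardSuperconductivity_of_scaleTransfer_of_construction
    (hT : ∀ δ ∈ Set.Ioo (0 : ℝ) (1 / 2), ∀ C : ℝ, 0 < C → ∃ U₀ : ℝ, 0 < U₀ ∧ ∀ U ∈ Set.Ioo (0 : ℝ) U₀, ∀ μ : ℝ,
      Filter.Tendsto (fun L : ℕ =>
          ((hubbardTorusWith 2 (L + 1) 1 U μ).groundStateFunctional totalNumber).re / ((L + 1 : ℕ) : ℝ) ^ 2)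
        Filter.atTop (nhds (1 - δ)) → Real.exp (-C / U ^ 2) ≤ dWaveOrderParameter U μ →
          HasDWavePairFieldLROAt U δ)
    (hC : WcbcsBcsConstruction) : _root_.HubbardSuperconductivity := by
  obtain ⟨δ, hδ, U₀, hU₀, C, hC0, h4⟩ := hC
  obtain ⟨U₁, hU₁, h2⟩ := hT δ hδ C hC0
  have hpos : (0 : ℝ) < min U₀ U₁ / 2 := half_pos (lt_min hU₀ hU₁)
  have hlt : min U₀ U₁ / 2 < min U₀ U₁ := half_lt_self (lt_min hU₀ hU₁)
  obtain ⟨μ, hdens, hm⟩ := h4 (min U₀ U₁ / 2) ⟨hpos, lt_of_lt_of_le hlt (min_le_left U₀ U₁)⟩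
  exact ⟨min U₀ U₁ / 2, hpos, δ, hδ,
    h2 (min U₀ U₁ / 2) ⟨hpos, lt_of_lt_of_le hlt (min_le_right U₀ U₁)⟩ μ hdens hm⟩

/-- **δ-first transfer + crux 4 ⇒ summit** (through the at-scale form). [folklore] -/
theorem hubbardSuperconductivity_of_swappedTransfer_of_construction
    (hT : ∀ δ ∈ Set.Ioo (0 : ℝ) (1 / 2), ∃ U₀ : ℝ, 0 < U₀ ∧ ∀ U ∈ Set.Ioo (0 : ℝ) U₀, ∀ μ : ℝ,
      Filter.Tendsto (fun L : ℕ =>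
          ((hubbardTorusWith 2 (L + 1) 1 U μ).groundStateFunctional totalNumber).re / ((L + 1 : ℕ) : ℝ) ^ 2)
        Filter.atTop (nhds (1 - δ)) → HasDWaveOrder U μ → HasDWavePairFieldLROAt U δ)
    (hC : WcbcsBcsConstruction) : _root_.HubbardSuperconductivity :=
  hubbardSuperconductivity_of_scaleTransfer_of_construction (scaleTransfer_of_swappedTransfer hT) hC

/-- **The strong hypothesis needs only the δ-first transfer on `(0, 2/5)`** plus the per-doping construction there:
both conjuncts pointwise in `δ`, matching the pointwise shape of `WeakCouplingDWaveWindow` itself.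
[cite: RaghuKivelsonScalapino2010, §III.B p. 6] -/
theorem weakCouplingDWaveWindow_of_swappedTransfer_of_windowConstruction
    (hT : ∀ δ ∈ Set.Ioo (0 : ℝ) (2 / 5), ∃ U₀ : ℝ, 0 < U₀ ∧ ∀ U ∈ Set.Ioo (0 : ℝ) U₀, ∀ μ : ℝ,
      Filter.Tendsto (fun L : ℕ =>
          ((hubbardTorusWith 2 (L + 1) 1 U μ).groundStateFunctional totalNumber).re / ((L + 1 : ℕ) : ℝ) ^ 2)
        Filter.atTop (nhds (1 - δ)) → HasDWaveOrder U μ → HasDWavePairFieldLROAt U δ)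
    (hC : ∀ δ ∈ Set.Ioo (0 : ℝ) (2 / 5), ∃ U₀ : ℝ, 0 < U₀ ∧ ∃ C : ℝ, 0 < C ∧ ∀ U ∈ Set.Ioo (0 : ℝ) U₀,
      ∃ μ : ℝ, Filter.Tendsto (fun L : ℕ =>
          ((hubbardTorusWith 2 (L + 1) 1 U μ).groundStateFunctional totalNumber).re / ((L + 1 : ℕ) : ℝ) ^ 2)
        Filter.atTop (nhds (1 - δ)) ∧ Real.exp (-C / U ^ 2) ≤ dWaveOrderParameter U μ) :
    WeakCouplingDWaveWindow := by
  intro δ hδ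
  obtain ⟨U₁, hU₁, hT⟩ := hT δ hδ
  obtain ⟨U₀, hU₀, C, _hC, hC⟩ := hC δ hδ
  refine ⟨min U₀ U₁, lt_min hU₀ hU₁, fun U hU => ?_⟩
  obtain ⟨μ, hdens, hm⟩ := hC U ⟨hU.1, lt_of_lt_of_le hU.2 (min_le_left _ _)⟩
  exact hT U ⟨hU.1, lt_of_lt_of_le hU.2 (min_le_right _ _)⟩ μ hdens
    ((hasDWaveOrder_iff _ _).2 (lt_of_lt_of_le (Real.exp_pos _) hm))

/-! ### §6 The SOURCED positive-temperature passage is closed too (appended 2026-08-26)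

§2 closed the two-point (LRO) passage at `T > 0`. The other conceivable positive-temperature carrier of pairing order
is the SOURCED (Bogoliubov quasi-average) order parameter — the thermal twin of the Koma–Tasaki object
`dWaveOrderParameter U μ = liminf_{h↓0} liminf_L Re ω₀^{L,h}(Δ_d)/L²` on which crux 4 `WcbcsBcsConstruction` is built.
The Literature theorem `thermal_dWaveSourceDensity_small` (`HohenbergMerminWagnerPairingQuasiAverage`, Su–Suzuki 1998
proved by the Koma–Tasaki/McBryan–Spencer gauge bound with a source) makes that twin trivial at EVERY `0 ≤ β < ∞`,
uniformly in `L, U, μ`. Recorded here as the negation of the natural positive-temperature analogue of `HasDWaveOrder`. -/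

/-- **B0e: no thermal sourced `d`-wave order at any temperature.** For every `β ≥ 0`, `U`, `μ` it is FALSE that the
Gibbs state of Koma–Tasaki's sourced torus `dWaveSourceTorus L U μ h = H(1,U) - μN - h(Δ_d + Δ_d†)` carries a sourced
`d`-wave order-parameter floor — i.e. there is NO `m > 0` such that for all small sources `h > 0`, eventually in the side
`L`, `m ≤ |⟨Δ_d⟩_{β,h,L}|/L²` (the `T > 0` analogue of `HasDWaveOrder U μ`, with `|·|` in place of `Re`, which only
strengthens the negation). Hence no bridge «KL-regime (or any `T > 0`) statement ⇒ thermal quasi-average `d`-wave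
order ⇒ …» exists either; together with §2, every positive-temperature carrier of pair ORDER is dead in `d = 2`, and
the bridge to the summit must be built on the `T = 0` objects of cruxes 4 and 2.
[cite: SuSuzuki1998, abstract and (13)–(14)] [cite: KomaTasakiPRL1992, p. 3 and footnote [10]] -/
theorem not_thermal_dWaveSourceOrder {β : ℝ} (hβ : 0 ≤ β) (U μ : ℝ) :
    ¬ ∃ m : ℝ, 0 < m ∧ ∃ h₀ : ℝ, 0 < h₀ ∧ ∀ h ∈ Set.Ioo (0 : ℝ) h₀, ∃ L₀ : ℕ, ∀ L : ℕ, L₀ ≤ L → ∀ [NeZero L],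
      m ≤ ‖Matrix.gibbsState β (dWaveSourceTorus L U μ h) (pairField dWaveFormFactor L)‖ / (L : ℝ) ^ 2 := by
  rintro ⟨m, hm, h₀, hh₀, hfloor⟩
  obtain ⟨h₁, hh₁, hsmall⟩ :=
    Literature.Barriers.HubbardSuperconductivity.thermal_dWaveSourceDensity_small hβ (half_pos hm)
  -- a source inside both windows
  set h : ℝ := min h₀ h₁ / 2 with hh
  have hpos : 0 < h := by positivity
  have hlt₀ : h < h₀ := by
    calc h = min h₀ h₁ / 2 := hh
      _ < min h₀ h₁ := half_lt_self (lt_min hh₀ hh₁)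
      _ ≤ h₀ := min_le_left _ _
  have hle₁ : |h| ≤ h₁ := by
    rw [abs_of_pos hpos]
    calc h = min h₀ h₁ / 2 := hh
      _ ≤ min h₀ h₁ := half_le_self (lt_min hh₀ hh₁).le
      _ ≤ h₁ := min_le_right _ _
  obtain ⟨L₀, hL₀⟩ := hfloor h ⟨hpos, hlt₀⟩
  haveI : NeZero (L₀ + 1) := ⟨Nat.succ_ne_zero L₀⟩
  have h1 := hL₀ (L₀ + 1) (Nat.le_succ L₀)
  have h2 := hsmall h hle₁ (L₀ + 1) U μ
  linarith

end Summit.HubbardSuperconductivity.WeakCouplingBCS.KLBridgeAudit
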